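import Mathlib
import HarnessLib
import Summits.AtomisticToContinuum.FouriersLaw.Theses.PhononMeanFreePath
import Summits.AtomisticToContinuum.FouriersLaw.Theses.JunctionLocality
import Summits.AtomisticToContinuum.FouriersLaw.Theorems.IncoherentChannel.Negative.LoadBearing

/-!
# Line `replica-ladder-thermal-drag` — skeleton for crux `PhononMeanFreePath.IncoherentChannel`
(item stmt-AtomisticToContinuum-11811; planner crux-plan seat, round 1; idea card
`Cruxes/IncoherentChannel/Ideas/replica-ladder-thermal-drag.md`, merge-partner `replica-depolarisation`;
triage r1: 3 × pass)

**Idea.** Double the `(N+1)`-site equal-temperature chain into two INDEPENDENT replicas `(x, x')`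
(law `μ₀ ⊗ μ₀`, kernels `K_t ⊗ K_t` — all constructed in the tree) and rotate the contact momenta by
45°: `π_b = (p_b + p_b')/√2` (common mode), `ϖ_b = (p_b − p_b')/√2` (differential mode). EXACTLY, at
every `N` and `t > 0`,
  `C_N(t) − 2 r_N(t)² = 2·Cov_ν(π₀(0)², ϖ_N(t)²)`,  `C_N(t) + 2 r_N(t)² = 2·Cov_ν(π₀(0)², π_N(t)²)`
(`stub_ladderIdentity`): the crux's connected four-point ("incoherent") channel IS the cross-leg —
common mode in, differential mode out: THERMAL DRAG — contact-to-contact heat covariance of an honest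
four-terminal oscillator network (two `pinnedChain` legs coupled only by the cross-Kerr rungs
`(3lam/4)σ²d²`, `(3β/4)(Δσ)²(Δd)²`, four Ornstein–Uhlenbeck terminals at `T`), and the coherent
channel is half the same-leg EXCESS. At the harmonic corner the legs decouple and the drag vanishes
identically (the replica rotation is then a symmetry; = the PROVED Wick identity
`Theorems/IncoherentChannel/Negative/HarmonicWick.harmonic_wick`), so every statement about the drag
evades `HarmonicChainBallisticFlux` structurally, not by estimate.

**Skeleton — 7 registered stubs ⇒ the crux BY NAME (`IncoherentChannel_of`, sorry-free, standard
axioms).** With `J_×(N) := ∫₀^∞ Cov_ν(π₀², ϖ_N(t)²) dt` (cross-leg) and `J_∥(N) := ∫₀^∞ Cov_ν(π₀², π_N(t)²) dt`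
(same-leg) the crux's sequence is `a_N = N(γ²/T²)·2J_×(N)`, and `a_N → κ_× > 0` is factored as
  EXISTENCE [`stub_dragMonotone` ⊕ `IncoherentBounded` (11815)]  ×  POSITIVITY [`ConductanceLowerBound`
  (11749, through `BoundaryKubo` 11812 under `NessUnique` 0741) ⊗ `stub_depolarisationFloor`],
transported to the crux by `stub_ladderIdentity`:
* `stub_ladderIdentity` (NEW; fixed `N`; L, provable with fixed-`N` tools) — the identity for `t > 0`
  plus integrability of the drag kernel on `(0,∞)` (the crux's hidden fixed-`N` content,
  `Negative/LoadBearing.eventually_integrableOn_of_crux`; CEHR exponential ergodicity);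
* `stub_nessUnique` = `PhononMeanFreePath.NessUnique` (0741), `stub_boundaryKubo` =
  `PhononMeanFreePath.BoundaryKubo` (11812: `D_{N+1} = N(γ²/T²)∫C_N`, IMPORTED not restated — triage r1-2),
  `stub_conductanceLowerBound` = `JunctionLocality.ConductanceLowerBound` (11749: `liminf D_N > 0`,
  shared), `stub_incoherentBounded` = `PhononMeanFreePath.IncoherentBounded` (11815: `sup|a_N| < ∞`) —
  four EXISTING items, entering by their route decl names;
* `stub_depolarisationFloor` (NEW; XL; THE anharmonic stub): `∃ ε > 0, ∀ᶠ N, ε·J_∥(N) ≤ J_×(N)` — the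
  depolarisation (drag) ratio `ρ_N = J_×/J_∥` stays eventually `≥ ε`: a fixed fraction of the heat
  transmitted along the ladder arrives in the differential mode. Rate-free, `N`-uniform, FALSE at
  `lam = β = 0` (`ρ ≡ 0`); strictly weaker than the sibling crux `CoherentDephasing` (`ρ_N → 1`) — the
  line never closes channel (A). MD (kit j008777, item evidence / NOTES-ideator3 §IV):
  `ρ_N = 0.07, 0.15, 0.23, 0.31` (`N = 1…4`, `lam·T = β·T = 1`), `0.09, 0.14` (`N = 2, 4` at `0.3`),
  harmonic controls `≈ 0`;
* `stub_dragMonotone` (NEW; XL; the HARDEST — all of the existence content): `N ↦ N·J_×(N)` is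
  EVENTUALLY MONOTONE, as the dichotomy (eventually ↑) ∨ (eventually ↓) — one sign between consecutive
  lengths for the DRAG entry of the ladder's terminal matrix (the lever of the lines of crux
  `BoundedResponseConverges`, stmt-9141, pointed at the cross-leg conductance; predicted branch ↑:
  `a_N = 0.03, 0.11, 0.23, 0.37`, `N = 1…4`, j008777). TRUE at the harmonic corner (`J_× ≡ 0`).
Proved glue: `eventually_le_drag` (0741 + 11812 + 11749 + identity + floor ⇒ `ε c ≤ a_N` eventually,
along the canonical steady-state family from the proved fact `pinnedChain_exists_isSteadyState`),
`dragConductivityExists_of` (monotone dichotomy + 11815 + the lower bound ⇒ `a_N` converges: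
`tendsto_atTop_ciSup` / `tendsto_atTop_ciInf` on the shifted sequence), `IncoherentChannel_of`
(`κ_× ≥ ε c > 0` by `ge_of_tendsto`; `crux_iff` is `Iff.rfl`).

**Disproof.lean (cdisprove gen 1, §0–§5) honoured.** `crux_false_without_gammaPos`: `γ > 0` enters at
11749 (and in the prefactor); `crux_false_without_TPos`: `T > 0` throughout (Gibbs law);
`crux_false_without_anharmonicity` / `HarmonicWick.not_crux_at_harmonic` (Wick identity PROVED): ONLY
`stub_depolarisationFloor` fails at `lam = β = 0` — identity, 0741, 11812, 11749 (RLL conductance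
`c_∞ > 0`, `D_N → ∞`), 11815 (`a_N ≡ 0`) and the monotone ladder (`a_N ≡ 0`) are all TRUE there — so
the skeleton localises the anharmonic content of the crux in ONE named rate-free statement; §1 hidden
integrability = conjunct (a) of `stub_ladderIdentity`; §3 `incoherentChannel_iff_fouriersLaw`: the line
does NOT take `CoherentDephasing`, so it is not the route's split read backwards (it delivers the crux
with `κ_B = κ_×` whatever the fate of channel (A)); §4: every stub is covariant under
`(lam, β, T) ↦ (lam·T, β·T, 1)`. `ledger negatives` (12 for the summit; FouriersLaw: only
`DiluteCellGaussianiser.FarFieldGaussianity`, about arbitrary dynamics/profiles): no stub instantiates one.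
-/

noncomputable section

open MeasureTheory Filter Topology Set
open scoped NNReal

namespace Summit.AtomisticToContinuum.FouriersLaw.Cruxes.IncoherentChannel.ReplicaLadderThermalDrag

open Literature.MathematicalPhysics.KineticTheory.HeatConduction
open Summit.AtomisticToContinuum.FouriersLaw.Theses

/-! ## §0 The crux's objects (chain of `N+1` sites `0 … N`, both baths at `T`) -/

section Objects

variable (ω₂ lam β γ : ℝ) (N : ℕ) (T : ℝ)

/-- `r_N(t) = ∫ p₀ · (K_t p_N) dμ₀` — verbatim the crux's two-point (coherent) function. -/
def rN (t : ℝ) : ℝ :=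
  ∫ z, z.2 0 * (∫ y, y.2 (Fin.last N)
    ∂((pinnedChain ω₂ lam β γ).transitionKernel (N + 1) T T t.toNNReal z))
    ∂((pinnedChain ω₂ lam β γ).gibbsMeasure (N + 1) T)

/-- `C_N(t) = ∫ p₀² (K_t p_N²) dμ₀ − (∫ p₀² dμ₀)(∫ K_t p_N² dμ₀)` — verbatim the crux's power–power
covariance. -/
def CN (t : ℝ) : ℝ :=
  (∫ z, (z.2 0) ^ 2 * (∫ y, (y.2 (Fin.last N)) ^ 2
      ∂((pinnedChain ω₂ lam β γ).transitionKernel (N + 1) T T t.toNNReal z))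
      ∂((pinnedChain ω₂ lam β γ).gibbsMeasure (N + 1) T)) -
    (∫ z, (z.2 0) ^ 2 ∂((pinnedChain ω₂ lam β γ).gibbsMeasure (N + 1) T)) *
      (∫ z, (∫ y, (y.2 (Fin.last N)) ^ 2
        ∂((pinnedChain ω₂ lam β γ).transitionKernel (N + 1) T T t.toNNReal z))
        ∂((pinnedChain ω₂ lam β γ).gibbsMeasure (N + 1) T))

/-- The crux, restated through `CN`/`rN` (definitionally the route decl: `crux_iff` is `Iff.rfl`). -/
def CruxViaCNrN : Prop :=
  ∀ ω₂ lam β γ : ℝ, 0 < ω₂ → 0 < lam → 0 < β → 0 < γ → ∀ T : ℝ, 0 < T → ∃ κ : ℝ, 0 < κ ∧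
    Tendsto (fun N : ℕ => (N : ℝ) * (γ ^ 2 / T ^ 2) *
      ∫ t in Ioi (0 : ℝ), (CN ω₂ lam β γ N T t - 2 * rN ω₂ lam β γ N T t ^ 2)) atTop (𝓝 κ)

theorem crux_iff : CruxViaCNrN ↔ PhononMeanFreePath.IncoherentChannel := Iff.rfl

/-! ## §1 The replica ladder: two independent copies, sum / difference contact modes -/

/-- Doubled phase space: a pair of replicas. -/
abbrev Pair (n : ℕ) : Type := PhaseSpace n × PhaseSpace n

/-- Sum-mode (common) momentum `π_b = (p_b + p_b')/√2`. -/
def sumMom {n : ℕ} (b : Fin n) (w : Pair n) : ℝ := (w.1.2 b + w.2.2 b) / Real.sqrt 2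

/-- Difference-mode momentum `ϖ_b = (p_b − p_b')/√2`. -/
def diffMom {n : ℕ} (b : Fin n) (w : Pair n) : ℝ := (w.1.2 b - w.2.2 b) / Real.sqrt 2

/-- Product equilibrium law `ν = μ₀ ⊗ μ₀` of the replica pair. -/
def pairGibbs : Measure (Pair (N + 1)) :=
  ((pinnedChain ω₂ lam β γ).gibbsMeasure (N + 1) T).prod ((pinnedChain ω₂ lam β γ).gibbsMeasure (N + 1) T)

/-- Product kernel `K_t ⊗ K_t` from the pair `w` (independent replica dynamics = the four-terminal
ladder with cross-Kerr rungs, all four Ornstein–Uhlenbeck terminals at `T`). -/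
def pairKernel (t : ℝ) (w : Pair (N + 1)) : Measure (Pair (N + 1)) :=
  ((pinnedChain ω₂ lam β γ).transitionKernel (N + 1) T T t.toNNReal w.1).prod
    ((pinnedChain ω₂ lam β γ).transitionKernel (N + 1) T T t.toNNReal w.2)

/-- CROSS-LEG ("thermal drag") kernel of the ladder: `Cov_ν(π₀(0)², ϖ_N(t)²)` — common mode in at
the near contact, differential mode out at the far contact. -/
def ladderCross (t : ℝ) : ℝ :=
  (∫ w, (sumMom 0 w) ^ 2 * (∫ v, (diffMom (Fin.last N) v) ^ 2 ∂(pairKernel ω₂ lam β γ N T t w))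
      ∂(pairGibbs ω₂ lam β γ N T)) -
    (∫ w, (sumMom 0 w) ^ 2 ∂(pairGibbs ω₂ lam β γ N T)) *
      (∫ w, (∫ v, (diffMom (Fin.last N) v) ^ 2 ∂(pairKernel ω₂ lam β γ N T t w))
        ∂(pairGibbs ω₂ lam β γ N T))

/-- SAME-LEG kernel of the ladder: `Cov_ν(π₀(0)², π_N(t)²)`. -/
def ladderSame (t : ℝ) : ℝ :=
  (∫ w, (sumMom 0 w) ^ 2 * (∫ v, (sumMom (Fin.last N) v) ^ 2 ∂(pairKernel ω₂ lam β γ N T t w))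
      ∂(pairGibbs ω₂ lam β γ N T)) -
    (∫ w, (sumMom 0 w) ^ 2 ∂(pairGibbs ω₂ lam β γ N T)) *
      (∫ w, (∫ v, (sumMom (Fin.last N) v) ^ 2 ∂(pairKernel ω₂ lam β γ N T t w))
        ∂(pairGibbs ω₂ lam β γ N T))

end Objects

/-! ## §2 Stub statements -/

/-- **Ladder identity (with integrability of the drag kernel)** — the lever; fixed `N`.
(a) `t ↦ Cov_ν(π₀², ϖ_N(t)²)` is integrable on `(0,∞)` (the hidden fixed-`N` content of the crux,
`Negative/LoadBearing.eventually_integrableOn_of_crux`; in substance CEHR 2018 exponential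
convergence in the `e^{θH}`-weighted norm, tree: `LangevinSemigroupHarris.exp_convergence_of_H2_of_minorization`);
(b) for every `t > 0` the cumulant channel is twice the cross-leg kernel and the "super-Wick" sum
`C_N + 2r_N²` twice the same-leg kernel — exact for the constructed objects: Fubini on `μ₀ ⊗ μ₀` and
on the product kernel, Markov property of `K_t`, `∫ p₀ dμ₀ = 0` (odd Gibbs moment,
`Negative/HarmonicFlow.integral_gibbsMeasure_eq_zero_of_odd`), `∫ K_t p_N dμ₀ = 0` (Gibbs invariance
of the kernels + oddness), integrability of `p₀²·K_t p_N²` etc. (`Negative/KernelMoments`,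
`Negative/GibbsStein`). TRUE at the harmonic corner (there (b) is the proved Wick identity, cross ≡ 0). -/
def LadderIdentity : Prop :=
  ∀ ω₂ lam β γ : ℝ, 0 < ω₂ → 0 < lam → 0 < β → 0 < γ → ∀ T : ℝ, 0 < T → ∀ N : ℕ,
    IntegrableOn (fun t : ℝ => ladderCross ω₂ lam β γ N T t) (Ioi 0) ∧
      ∀ t : ℝ, 0 < t →
        CN ω₂ lam β γ N T t - 2 * rN ω₂ lam β γ N T t ^ 2 = 2 * ladderCross ω₂ lam β γ N T t ∧
          CN ω₂ lam β γ N T t + 2 * rN ω₂ lam β γ N T t ^ 2 = 2 * ladderSame ω₂ lam β γ N T t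

/-- **Depolarisation floor** (the line's anharmonic, rate-free stub): the depolarisation (drag)
ratio `ρ_N = J_×(N)/J_∥(N)` of the replica ladder is eventually bounded below — a fixed fraction of
the heat transmitted from contact `0` to contact `N` arrives in the differential mode ("the ladder
conducts across legs"). FALSE at the harmonic corner (`J_× ≡ 0` by the proved Wick identity while
`J_∥ > 0` is the Rieder–Lebowitz–Lieb conductance), so this is where `lam, β > 0` must be used;
strictly weaker than the sibling crux `CoherentDephasing` (`ρ_N → 1`). Time-integrated and
eventual in `N` only (the pointwise kernel has negative short-time and echo lobes at small `N`:
triage r1-1 / r1-3 tables, kit j008777). MD (j008777): `ρ_N = 0.07, 0.15, 0.23, 0.31`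
(`N = 1…4`, `lam·T = β·T = 1`), `0.09, 0.14` (`N = 2, 4` at `0.3`), harmonic `≈ 0`. -/
def DepolarisationFloor : Prop :=
  ∀ ω₂ lam β γ : ℝ, 0 < ω₂ → 0 < lam → 0 < β → 0 < γ → ∀ T : ℝ, 0 < T → ∃ ε : ℝ, 0 < ε ∧
    ∀ᶠ N : ℕ in atTop,
      ε * (∫ t in Ioi (0 : ℝ), ladderSame ω₂ lam β γ N T t) ≤ ∫ t in Ioi (0 : ℝ), ladderCross ω₂ lam β γ N T t

/-- **Drag monotone ladder** (the existence engine; the hardest new stub): the length-rescaled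
cross-leg transconductance `N ↦ N·J_×(N)` (`= a_N·T²/(2γ²)`) is EVENTUALLY MONOTONE — stated as the
dichotomy "eventually non-decreasing OR eventually non-increasing" (the sign of
`(N+1)J_×(N+1) − N J_×(N)` is eventually constant), the same one-sign-between-consecutive-lengths
lever as the lines of crux `BoundedResponseConverges` (stmt-9141), here for the DRAG entry of the
ladder's terminal matrix. Predicted branch: non-decreasing (`a_N = κ_N − N·G_coh`, `κ_N = N G_N ↑ κ`
from below by the contact resistance, `N G_coh ↓ 0`; MD: `a_N = 0.03, 0.11, 0.23, 0.37` for
`N = 1…4` at `lam·T = 1`, kit j008777; `0.05, 0.15–0.2, 0.25–0.33` for `N = 1, 2, 4`, cdisprove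
j008159). TRUE at the harmonic corner (`J_× ≡ 0`). With the route's `IncoherentBounded` (11815) it
is CONVERGENCE of `a_N` (monotone convergence); no limit object, no rate. -/
def DragMonotone : Prop :=
  ∀ ω₂ lam β γ : ℝ, 0 < ω₂ → 0 < lam → 0 < β → 0 < γ → ∀ T : ℝ, 0 < T →
    (∃ N₁ : ℕ, ∀ N : ℕ, N₁ ≤ N →
        (N : ℝ) * (∫ t in Ioi (0 : ℝ), ladderCross ω₂ lam β γ N T t) ≤
          ((N + 1 : ℕ) : ℝ) * ∫ t in Ioi (0 : ℝ), ladderCross ω₂ lam β γ (N + 1) T t) ∨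
      (∃ N₁ : ℕ, ∀ N : ℕ, N₁ ≤ N →
        ((N + 1 : ℕ) : ℝ) * (∫ t in Ioi (0 : ℝ), ladderCross ω₂ lam β γ (N + 1) T t) ≤
          (N : ℝ) * ∫ t in Ioi (0 : ℝ), ladderCross ω₂ lam β γ N T t)

/-- DERIVED (not a stub): existence of the drag conductivity — `N(γ²/T²)·2J_×(N)` converges to
some real number. Obtained below from `DragMonotone`, the route's `IncoherentBounded` and the
eventual lower bound (`dragConductivityExists_of`); recorded as the existence HALF of the crux in
ladder form (positivity is the other half: 11749 ⊗ `DepolarisationFloor`). -/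
def DragConductivityExists : Prop :=
  ∀ ω₂ lam β γ : ℝ, 0 < ω₂ → 0 < lam → 0 < β → 0 < γ → ∀ T : ℝ, 0 < T →
    ∃ κ : ℝ, Tendsto (fun N : ℕ => (N : ℝ) * (γ ^ 2 / T ^ 2) *
      ∫ t in Ioi (0 : ℝ), 2 * ladderCross ω₂ lam β γ N T t) atTop (𝓝 κ)

/-! ## §3 Registered stubs

The `stub_*` theorems are the registered obligations (sorried). `Registered.stub_*` are the
name-keyed `abbrev` aliases of the three NEW statements, taken as hypotheses of
`IncoherentChannel_of` (device of `Cruxes/BoundedResponseConverges/Lines/ohmic-floor-monotone-ladder.lean`);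
the four IMPORTED items enter `IncoherentChannel_of` under their route decl names. -/

namespace Registered

/-- Alias of `LadderIdentity` keyed by the registered stub name. -/
abbrev stub_ladderIdentity : Prop := LadderIdentity
/-- Alias of `DepolarisationFloor` keyed by the registered stub name. -/
abbrev stub_depolarisationFloor : Prop := DepolarisationFloor
/-- Alias of `DragMonotone` keyed by the registered stub name. -/
abbrev stub_dragMonotone : Prop := DragMonotone

end Registered

/-- STUB 1 (the lever; fixed `N`; L — provable with fixed-`N` tools): ladder identity +
integrability of the drag kernel. -/
theorem stub_ladderIdentity : LadderIdentity := by
  sorry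

/-- STUB 2 (= route item stmt-AtomisticToContinuum-0741 `PhononMeanFreePath.NessUnique`, shared
support, M/L): weak-NESS uniqueness. -/
theorem stub_nessUnique : PhononMeanFreePath.NessUnique := by
  sorry

/-- STUB 3 (= route item stmt-AtomisticToContinuum-11812 `PhononMeanFreePath.BoundaryKubo`, crux
rank 4, L): `D_{N+1} = N(γ²/T²)∫₀^∞ C_N` along any steady-state family, under uniqueness —
IMPORTED, not restated (triage r1-2). -/
theorem stub_boundaryKubo : PhononMeanFreePath.BoundaryKubo := by
  sorry

/-- STUB 4 (= item stmt-AtomisticToContinuum-11749 `JunctionLocality.ConductanceLowerBound`,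
shared with ParityLiouvilleSeed / StaticAbelianSqueeze and with line ohmic-floor-monotone-ladder of
crux 9141; XL): `liminf_N D_N > 0`. TRUE at the harmonic corner; uses `γ > 0`. -/
theorem stub_conductanceLowerBound : JunctionLocality.ConductanceLowerBound := by
  sorry

/-- STUB 5 (= route item stmt-AtomisticToContinuum-11815 `PhononMeanFreePath.IncoherentBounded`,
support, XL): `sup_N |a_N| < ∞` — the finiteness half of the crux. TRUE at the harmonic corner. -/
theorem stub_incoherentBounded : PhononMeanFreePath.IncoherentBounded := by
  sorry

/-- STUB 6 (new; XL; THE anharmonic stub): the depolarisation floor. -/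
theorem stub_depolarisationFloor : DepolarisationFloor := by
  sorry

/-- STUB 7 (new; XL; the HARDEST — all of the existence content): the drag monotone ladder. -/
theorem stub_dragMonotone : DragMonotone := by
  sorry

/-! ## §4 Glue (PROVED): real analysis of eventually monotone sequences -/

/-- An eventually non-decreasing real sequence bounded above converges. -/
theorem tendsto_of_eventually_mono_bddAbove {a : ℕ → ℝ} {N₁ : ℕ} {B : ℝ}
    (hmono : ∀ N : ℕ, N₁ ≤ N → a N ≤ a (N + 1)) (hB : ∀ N : ℕ, a N ≤ B) :
    ∃ κ : ℝ, Tendsto a atTop (𝓝 κ) := by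
  have hf : Monotone (fun n : ℕ => a (n + N₁)) := by
    refine monotone_nat_of_le_succ fun n => ?_
    have h := hmono (n + N₁) (by omega)
    have e : n + 1 + N₁ = n + N₁ + 1 := by omega
    simpa [e] using h
  have hbdd : BddAbove (Set.range fun n : ℕ => a (n + N₁)) := by
    refine ⟨B, ?_⟩
    rintro _ ⟨n, rfl⟩
    exact hB _
  exact ⟨_, (tendsto_add_atTop_iff_nat N₁).1 (tendsto_atTop_ciSup hf hbdd)⟩

/-- An eventually non-increasing real sequence eventually bounded below converges. -/
theorem tendsto_of_eventually_anti_bddBelow {a : ℕ → ℝ} {N₁ : ℕ} {b : ℝ}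
    (hanti : ∀ N : ℕ, N₁ ≤ N → a (N + 1) ≤ a N) (hb : ∀ N : ℕ, N₁ ≤ N → b ≤ a N) :
    ∃ κ : ℝ, Tendsto a atTop (𝓝 κ) := by
  have hf : Antitone (fun n : ℕ => a (n + N₁)) := by
    refine antitone_nat_of_succ_le fun n => ?_
    have h := hanti (n + N₁) (by omega)
    have e : n + 1 + N₁ = n + N₁ + 1 := by omega
    simpa [e] using h
  have hbdd : BddBelow (Set.range fun n : ℕ => a (n + N₁)) := by
    refine ⟨b, ?_⟩
    rintro _ ⟨n, rfl⟩
    exact hb _ (by omega)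
  exact ⟨_, (tendsto_add_atTop_iff_nat N₁).1 (tendsto_atTop_ciInf hf hbdd)⟩

/-- An eventually monotone (either direction) real sequence that is bounded above and eventually
bounded below converges. -/
theorem tendsto_of_eventually_monotone_of_bounds {a : ℕ → ℝ} {B b : ℝ} {N₀ : ℕ}
    (hmono : (∃ N₁ : ℕ, ∀ N : ℕ, N₁ ≤ N → a N ≤ a (N + 1)) ∨
      (∃ N₁ : ℕ, ∀ N : ℕ, N₁ ≤ N → a (N + 1) ≤ a N))
    (hB : ∀ N : ℕ, a N ≤ B) (hb : ∀ N : ℕ, N₀ ≤ N → b ≤ a N) :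
    ∃ κ : ℝ, Tendsto a atTop (𝓝 κ) := by
  rcases hmono with ⟨N₁, h⟩ | ⟨N₁, h⟩
  · exact tendsto_of_eventually_mono_bddAbove h hB
  · refine tendsto_of_eventually_anti_bddBelow (N₁ := max N₁ N₀) (b := b) ?_ ?_
    · exact fun N hN => h N (le_trans (le_max_left _ _) hN)
    · exact fun N hN => hb N (le_trans (le_max_right _ _) hN)

/-! ## §5 The composition (kernel-checked, no `sorry`): the seven stubs imply the crux BY NAME -/

/-- **The lower-bound half, assembled.** Along the canonical steady-state family (proved fact
`pinnedChain_exists_isSteadyState`), `BoundaryKubo` identifies `D_{N+1} = N g ∫C_N` (`g = γ²/T²`),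
`ConductanceLowerBound` gives `c ≤ N g ∫C_N` for large `N`, the ladder identity and the
depolarisation floor give `∫C_N − 2∫r_N² ≥ ε(∫C_N + 2∫r_N²) ≥ ε∫C_N`; hence `ε c ≤ a_N`
eventually, with `a_N = N g ∫ 2·ladderCross`. -/
theorem eventually_le_drag (hI : LadderIdentity) (hU : PhononMeanFreePath.NessUnique)
    (hK : PhononMeanFreePath.BoundaryKubo) (hL : JunctionLocality.ConductanceLowerBound)
    (hF : DepolarisationFloor) {ω₂ lam β γ : ℝ} (hω : 0 < ω₂) (hl : 0 < lam) (hβ : 0 < β)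
    (hγ : 0 < γ) {T : ℝ} (hT : 0 < T) :
    ∃ m : ℝ, 0 < m ∧ ∀ᶠ N : ℕ in atTop, m ≤ (N : ℝ) * (γ ^ 2 / T ^ 2) *
      ∫ t in Ioi (0 : ℝ), 2 * ladderCross ω₂ lam β γ N T t := by
  have hI' := hI ω₂ lam β γ hω hl hβ hγ T hT
  have huniq := hU ω₂ lam β γ hω hl hβ hγ
  obtain ⟨ε, hε, hFev⟩ := hF ω₂ lam β γ hω hl hβ hγ T hT
  classical
  -- the canonical steady-state family (junk `0` off the positive quadrant of temperatures)
  let μ : (n : ℕ) → ℝ → ℝ → Measure (PhaseSpace n) := fun n T_L T_R =>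
    if h : 0 < T_L ∧ 0 < T_R then
      Classical.choose (pinnedChain_exists_isSteadyState hω hl hβ hγ n h.1 h.2) else 0
  have hμ : ∀ (n : ℕ) (T_L T_R : ℝ), 0 < T_L → 0 < T_R →
      (pinnedChain ω₂ lam β γ).IsSteadyState n T_L T_R (μ n T_L T_R) := by
    intro n T_L T_R hL' hR'
    simp only [μ, dif_pos (And.intro hL' hR')]
    exact Classical.choose_spec (pinnedChain_exists_isSteadyState hω hl hβ hγ n hL' hR')
  -- boundary Kubo along this family: `C_N ∈ L¹(0,∞)` and `D_{N+1} = N g ∫ C_N`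
  have hKT := hK ω₂ lam β γ hω hl hβ hγ huniq μ hμ T hT
  have hCint : ∀ N : ℕ, IntegrableOn (fun t : ℝ => CN ω₂ lam β γ N T t) (Ioi 0) := fun N => (hKT N).1
  -- the response coefficients `D 0 = 0`, `D (N+1) = N g ∫ C_N`
  let D : ℕ → ℝ := fun M => ((M - 1 : ℕ) : ℝ) * (γ ^ 2 / T ^ 2) * ∫ t in Ioi (0 : ℝ), CN ω₂ lam β γ (M - 1) T t
  have hD : ∀ M : ℕ, Tendsto (fun δ : ℝ =>
      (pinnedChain ω₂ lam β γ).totalCurrent (μ M (T + δ / 2) (T - δ / 2)) / δ)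
      (nhdsWithin 0 {(0 : ℝ)}ᶜ) (𝓝 (D M)) := by
    intro M
    cases M with
    | zero =>
      have h0 : D 0 = 0 := by simp [D]
      rw [h0]
      simp only [OscillatorChain.totalCurrent_zero, zero_div]
      exact tendsto_const_nhds
    | succ N =>
      have hN : D (N + 1) = (N : ℝ) * (γ ^ 2 / T ^ 2) * ∫ t in Ioi (0 : ℝ), CN ω₂ lam β γ N T t := by
        simp [D]
      rw [hN]
      exact (hKT N).2
  -- the transport lower bound (item 11749): `c ≤ D_M` for `M ≥ N₁`
  obtain ⟨c, hc, N₁, hN₁⟩ := hL ω₂ lam β γ hω hl hβ hγ huniq μ hμ T hT D hD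
  have hlow : ∀ N : ℕ, N₁ ≤ N → c ≤ (N : ℝ) * (γ ^ 2 / T ^ 2) * ∫ t in Ioi (0 : ℝ), CN ω₂ lam β γ N T t := by
    intro N hN
    have h := hN₁ (N + 1) (by omega)
    simpa [D] using h
  refine ⟨ε * c, mul_pos hε hc, ?_⟩
  filter_upwards [hFev, eventually_ge_atTop N₁] with N hFN hNN
  -- integrability bookkeeping at this `N`
  have hC : IntegrableOn (fun t : ℝ => CN ω₂ lam β γ N T t) (Ioi 0) := hCint N
  have hX2 : IntegrableOn (fun t : ℝ => 2 * ladderCross ω₂ lam β γ N T t) (Ioi 0) :=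
    ((hI' N).1).const_mul 2
  have hcumInt : IntegrableOn (fun t : ℝ => CN ω₂ lam β γ N T t - 2 * rN ω₂ lam β γ N T t ^ 2) (Ioi 0) :=
    hX2.congr_fun (fun t ht => (((hI' N).2 t ht).1).symm) measurableSet_Ioi
  have hR : IntegrableOn (fun t : ℝ => 2 * rN ω₂ lam β γ N T t ^ 2) (Ioi 0) :=
    (hC.sub hcumInt).congr_fun (fun t _ => by simp only [Pi.sub_apply]; ring) measurableSet_Ioi
  -- the three integrals
  set IC : ℝ := ∫ t in Ioi (0 : ℝ), CN ω₂ lam β γ N T t with hIC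
  set IR : ℝ := ∫ t in Ioi (0 : ℝ), 2 * rN ω₂ lam β γ N T t ^ 2 with hIR
  have hIRnn : 0 ≤ IR := by
    rw [hIR]
    exact setIntegral_nonneg measurableSet_Ioi fun t _ => by positivity
  have hcum : (∫ t in Ioi (0 : ℝ), (CN ω₂ lam β γ N T t - 2 * rN ω₂ lam β γ N T t ^ 2)) =
      ∫ t in Ioi (0 : ℝ), 2 * ladderCross ω₂ lam β γ N T t :=
    setIntegral_congr_fun measurableSet_Ioi fun t ht => ((hI' N).2 t ht).1
  have hcross : (∫ t in Ioi (0 : ℝ), 2 * ladderCross ω₂ lam β γ N T t) = IC - IR := by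
    rw [← hcum, hIC, hIR]
    exact integral_sub hC hR
  have hsame : (∫ t in Ioi (0 : ℝ), ladderSame ω₂ lam β γ N T t) = (IC + IR) / 2 := by
    have h2 : (∫ t in Ioi (0 : ℝ), 2 * ladderSame ω₂ lam β γ N T t) =
        ∫ t in Ioi (0 : ℝ), (CN ω₂ lam β γ N T t + 2 * rN ω₂ lam β γ N T t ^ 2) :=
      setIntegral_congr_fun measurableSet_Ioi fun t ht => (((hI' N).2 t ht).2).symm
    have h3 : (∫ t in Ioi (0 : ℝ), 2 * ladderSame ω₂ lam β γ N T t) =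
        2 * ∫ t in Ioi (0 : ℝ), ladderSame ω₂ lam β γ N T t := integral_const_mul _ _
    rw [integral_add hC hR, ← hIC, ← hIR] at h2
    linarith
  have hcross1 : (∫ t in Ioi (0 : ℝ), ladderCross ω₂ lam β γ N T t) = (IC - IR) / 2 := by
    have h3 : (∫ t in Ioi (0 : ℝ), 2 * ladderCross ω₂ lam β γ N T t) =
        2 * ∫ t in Ioi (0 : ℝ), ladderCross ω₂ lam β γ N T t := integral_const_mul _ _
    linarith
  -- the floor: ε (IC + IR)/2 ≤ (IC − IR)/2, hence IC − IR ≥ ε IC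
  rw [hsame, hcross1] at hFN
  have hkey : ε * IC ≤ IC - IR := by nlinarith
  -- the transport lower bound at this `N`
  have hlowN : c ≤ (N : ℝ) * (γ ^ 2 / T ^ 2) * IC := hlow N hNN
  have hg : 0 ≤ (N : ℝ) * (γ ^ 2 / T ^ 2) := by positivity
  rw [hcross]
  calc ε * c ≤ ε * ((N : ℝ) * (γ ^ 2 / T ^ 2) * IC) := mul_le_mul_of_nonneg_left hlowN hε.le
    _ = (N : ℝ) * (γ ^ 2 / T ^ 2) * (ε * IC) := by ring
    _ ≤ (N : ℝ) * (γ ^ 2 / T ^ 2) * (IC - IR) := mul_le_mul_of_nonneg_left hkey hg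

/-- **The existence half, assembled**: `DragMonotone` + the route's `IncoherentBounded` (upper
bound, transported through the ladder identity) + the eventual lower bound ⇒ the drag
conductivity exists. -/
theorem dragConductivityExists_of (hI : LadderIdentity) (hU : PhononMeanFreePath.NessUnique)
    (hK : PhononMeanFreePath.BoundaryKubo) (hL : JunctionLocality.ConductanceLowerBound)
    (hB : PhononMeanFreePath.IncoherentBounded) (hF : DepolarisationFloor) (hM : DragMonotone) :
    DragConductivityExists := by
  intro ω₂ lam β γ hω hl hβ hγ T hT
  have hI' := hI ω₂ lam β γ hω hl hβ hγ T hT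
  obtain ⟨m, -, hm⟩ := eventually_le_drag hI hU hK hL hF hω hl hβ hγ hT
  obtain ⟨B, hBN⟩ := hB ω₂ lam β γ hω hl hβ hγ T hT
  have hMT := hM ω₂ lam β γ hω hl hβ hγ T hT
  -- the sequence in crux form equals the ladder form
  have hcum : ∀ N : ℕ, (∫ t in Ioi (0 : ℝ), (CN ω₂ lam β γ N T t - 2 * rN ω₂ lam β γ N T t ^ 2)) =
      ∫ t in Ioi (0 : ℝ), 2 * ladderCross ω₂ lam β γ N T t := fun N =>
    setIntegral_congr_fun measurableSet_Ioi fun t ht => ((hI' N).2 t ht).1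
  have h2 : ∀ N : ℕ, (∫ t in Ioi (0 : ℝ), 2 * ladderCross ω₂ lam β γ N T t) =
      2 * ∫ t in Ioi (0 : ℝ), ladderCross ω₂ lam β γ N T t := fun N => integral_const_mul _ _
  -- a_N = 2 g · (N · J_×(N))
  set a : ℕ → ℝ := fun N => (N : ℝ) * (γ ^ 2 / T ^ 2) *
    ∫ t in Ioi (0 : ℝ), 2 * ladderCross ω₂ lam β γ N T t with ha
  have hag : ∀ N : ℕ, a N = 2 * (γ ^ 2 / T ^ 2) *
      ((N : ℝ) * ∫ t in Ioi (0 : ℝ), ladderCross ω₂ lam β γ N T t) := by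
    intro N
    simp only [ha, h2]
    ring
  have hgpos : 0 ≤ 2 * (γ ^ 2 / T ^ 2) := by positivity
  -- upper bound from IncoherentBounded (crux form → ladder form)
  have hupper : ∀ N : ℕ, a N ≤ B := by
    intro N
    have h : |(N : ℝ) * (γ ^ 2 / T ^ 2) *
        ∫ t in Ioi (0 : ℝ), (CN ω₂ lam β γ N T t - 2 * rN ω₂ lam β γ N T t ^ 2)| ≤ B := hBN N
    rw [hcum N] at h
    exact (le_abs_self _).trans h
  -- eventual lower bound
  obtain ⟨N₀, hN₀⟩ := eventually_atTop.1 hm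
  -- eventual monotonicity, transported by the positive factor 2g
  have hmono : (∃ N₁ : ℕ, ∀ N : ℕ, N₁ ≤ N → a N ≤ a (N + 1)) ∨
      (∃ N₁ : ℕ, ∀ N : ℕ, N₁ ≤ N → a (N + 1) ≤ a N) := by
    rcases hMT with ⟨N₁, h⟩ | ⟨N₁, h⟩
    · refine Or.inl ⟨N₁, fun N hN => ?_⟩
      rw [hag N, hag (N + 1)]
      exact mul_le_mul_of_nonneg_left (h N hN) hgpos
    · refine Or.inr ⟨N₁, fun N hN => ?_⟩
      rw [hag N, hag (N + 1)]
      exact mul_le_mul_of_nonneg_left (h N hN) hgpos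
  exact tendsto_of_eventually_monotone_of_bounds hmono hupper hN₀

/-- **`IncoherentChannel` from the replica-ladder line** (the seven registered stubs, BY NAME):
existence (`dragConductivityExists_of`) gives `a_N → κ_×`; the lower-bound half
(`eventually_le_drag`) gives `a_N ≥ ε c` eventually; hence `κ_× ≥ ε c > 0`, and `a_N` is the
crux's sequence by the ladder identity. -/
theorem IncoherentChannel_of :
    Registered.stub_ladderIdentity → PhononMeanFreePath.NessUnique → PhononMeanFreePath.BoundaryKubo →
      JunctionLocality.ConductanceLowerBound → PhononMeanFreePath.IncoherentBounded →
        Registered.stub_depolarisationFloor → Registered.stub_dragMonotone →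
          PhononMeanFreePath.IncoherentChannel := by
  intro hI hU hK hL hB hF hM
  rw [← crux_iff]
  intro ω₂ lam β γ hω hl hβ hγ T hT
  have hI' := hI ω₂ lam β γ hω hl hβ hγ T hT
  obtain ⟨m, hmpos, hm⟩ := eventually_le_drag hI hU hK hL hF hω hl hβ hγ hT
  obtain ⟨κ, hκ⟩ := dragConductivityExists_of hI hU hK hL hB hF hM ω₂ lam β γ hω hl hβ hγ T hT
  have hcum : ∀ N : ℕ, (∫ t in Ioi (0 : ℝ), (CN ω₂ lam β γ N T t - 2 * rN ω₂ lam β γ N T t ^ 2)) =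
      ∫ t in Ioi (0 : ℝ), 2 * ladderCross ω₂ lam β γ N T t := fun N =>
    setIntegral_congr_fun measurableSet_Ioi fun t ht => ((hI' N).2 t ht).1
  refine ⟨κ, ?_, ?_⟩
  · have hκge : m ≤ κ := ge_of_tendsto hκ hm
    linarith
  · have hfun : (fun N : ℕ => (N : ℝ) * (γ ^ 2 / T ^ 2) *
        ∫ t in Ioi (0 : ℝ), (CN ω₂ lam β γ N T t - 2 * rN ω₂ lam β γ N T t ^ 2)) =
        fun N : ℕ => (N : ℝ) * (γ ^ 2 / T ^ 2) * ∫ t in Ioi (0 : ℝ), 2 * ladderCross ω₂ lam β γ N T t :=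
      funext fun N => by rw [hcum N]
    rw [hfun]
    exact hκ

end Summit.AtomisticToContinuum.FouriersLaw.Cruxes.IncoherentChannel.ReplicaLadderThermalDrag

end
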